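import Literature.Computability.FineGrained.SchoeningMachinePasses
import HarnessLib

/-!
# Schöning's random walk for k-SAT, IV: the stack machine — scanning for a violated clause

Topic `Literature/Computability/FineGrained`, sequel of `SchoeningMachinePasses.lean` (same
register conventions). This file programs and verifies **the scan pass** `scan` over the
formula register `f`: with the current assignment `al` coded in `f2`, every literal `(y, b)`
of every clause is evaluated by the assignment pass in mode `val` (`lookup`, its index poured
from `xr` into the query register `x`), a satisfied clause raises `sat`, and at the end of a
clause (`endc`) the first violated clause — if no clause was found before (`he` down) and this
one is not satisfied — is poured from the clause buffer `lb` into `cb` and `he` is raised.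
Functional effect (`runs_scan`): `he = flag (firstViolated F al).isSome`, `cb` = the code of
the first violated clause (`scanOut`), all other registers restored; cost
`≤ 105 (|code al| + 1) |code F| + 3 |code F| + 2`.

## References

* U. Schöning, FOCS 1999 (the algorithm: "find a clause C that is not satisfied").
  [SchoeningFOCS1999]
* F. V. Fomin, D. Kratsch, *Exact Exponential Algorithms*, Springer 2010, Fig. 8.2.
* T. Nipkow, G. Klein, *Concrete Semantics with Isabelle/HOL*, Springer 2014, Ch. 7.
-/

namespace Literature.Computability.FineGrained.Schoening

open Complexity Complexity.Com LightSearch _root_.Computability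

/-! ### The scan pass -/

/-- Handler of an index bit: re-emit it on `fr`, buffer it on `lb`, collect it on `xr`.
[folklore] -/
def scBit (b : Bool) : Com R := emit .fr (.bit b) ;; emit .lb (.bit b) ;; .push .xr b

/-- Handler of the end of a literal `(y, b)`: re-emit and buffer `pol b`; the index collected
on `xr` becomes the query `x`; the assignment pass in mode `val` leaves `valOf al y` in `ls`;
the literal is true iff that value is `b`, which raises `sat`; the query is cleared.
[folklore] -/
def scPol (b : Bool) : Com R :=
  emit .fr (.pol b) ;; emit .lb (.pol b) ;; pour .xr .x ;; lookup .val ;;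
  popFlag .ls (if b then setFlag .sat else .skip) (if b then .skip else setFlag .sat) ;; clear .x

/-- Handler of the end of a clause: re-emit and buffer `endc`; if a violated clause was found
earlier (`he`) discard the buffer and reset `sat`; otherwise a satisfied clause is discarded
and a violated one is poured into `cb`, raising `he`. [folklore] -/
def scEndc : Com R :=
  emit .fr .endc ;; emit .lb .endc ;;
  popFlag .he (.push .he true ;; clear .lb ;; popFlag .sat .skip .skip)
    (popFlag .sat (clear .lb) (pour .lb .cb ;; .push .he true))

/-- The handlers of the scan pass. [folklore] -/
def scH : Handlers := ⟨scBit, scPol, .skip, scEndc, .skip, .skip, .skip⟩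

/-- The handlers by token. [folklore] -/
theorem scH_run (t : Tok) : scH.run t =
    (match t with
      | .bit b => scBit b
      | .pol b => scPol b
      | .endc => scEndc
      | _ => .skip) := by
  cases t <;> rfl

/-- **The scan pass**: the token loop over `f`, then pour the re-emitted formula back.
[folklore] -/
def scan : Com R := tokLoop .f scH ;; pour .fr .f

/-! ### Functional model -/

/-- The effect of one clause on the pair (found flag, clause register): once found nothing
changes; otherwise a satisfied clause leaves `(false, cb)`, a violated one is recorded.
[folklore] -/
def scanStep (al : Assg) (c : Clause (List Bool)) (st : Bool × List Bool) : Bool × List Bool :=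
  if st.1 then st else if Clause.eval (valOf al) c then (false, st.2) else (true, bits (cToks c) ++ st.2)

/-- The effect of a clause list. [folklore] -/
def scanFold (al : Assg) (F : CNF (List Bool)) (st : Bool × List Bool) : Bool × List Bool :=
  F.foldl (fun st c => scanStep al c st) st

/-- `scanFold` on a cons. [folklore] -/
@[simp] theorem scanFold_cons (al : Assg) (c : Clause (List Bool)) (F : CNF (List Bool)) (st : Bool × List Bool) :
    scanFold al (c :: F) st = scanFold al F (scanStep al c st) := rfl

/-- `scanFold` on nil. [folklore] -/
@[simp] theorem scanFold_nil (al : Assg) (st : Bool × List Bool) : scanFold al [] st = st := rfl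

/-- Once a clause is found the state is frozen. [folklore] -/
theorem scanFold_true (al : Assg) (F : CNF (List Bool)) (cb : List Bool) : scanFold al F (true, cb) = (true, cb) := by
  induction F with
  | nil => rfl
  | cons c F ih => rw [scanFold_cons, scanStep, if_pos rfl, ih]

/-- The output of the scan: the code of the first violated clause, if any. [folklore] -/
def scanOut (F : CNF (List Bool)) (al : Assg) : List Bool :=
  match firstViolated F al with
  | none => []
  | some C => bits (cToks C)

/-- **The scan computes `firstViolated`**: from `(false, [])` the fold ends in
`((firstViolated F al).isSome, scanOut F al)`. [folklore] -/
theorem scanFold_eq (al : Assg) (F : CNF (List Bool)) :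
    scanFold al F (false, []) = ((firstViolated F al).isSome, scanOut F al) := by
  unfold scanOut firstViolated
  induction F with
  | nil => simp
  | cons c F ih =>
    rw [scanFold_cons, scanStep, if_neg (by simp), List.find?_cons]
    by_cases hc : Clause.eval (valOf al) c = true
    · rw [if_pos hc]; simpa [hc] using ih
    · rw [if_neg hc]
      have : (!Clause.eval (valOf al) c) = true := by simpa using hc
      simp [this, scanFold_true]

/-! ### Simulation: the literals of a clause -/

/-- **The index bits of a literal** (continuation-passing form): each bit is re-emitted on
`fr`, buffered on `lb`, collected on `xr`; `21` steps per bit. [folklore] -/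
theorem runs_scBits : ∀ (ys fr lb xr rest : List Bool) (ρ : RF) {R₂ : Regs R} {B₂ : ℕ},
    Runs (tokLoop .f scH)
      (mk { ρ with
            f := rest, fr := (bits (ys.map Tok.bit)).reverse ++ fr
            lb := (bits (ys.map Tok.bit)).reverse ++ lb, xr := ys.reverse ++ xr }) R₂ B₂ →
    Runs (tokLoop .f scH)
      (mk { ρ with f := bits (ys.map Tok.bit) ++ rest, fr := fr, lb := lb, xr := xr }) R₂ (21 * ys.length + B₂)
  | [], fr, lb, xr, rest, ρ, R₂, B₂, hcont => by
    refine (hcont.of_eq_init ?_).mono (by simp)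
    simp
  | b :: ys, fr, lb, xr, rest, ρ, R₂, B₂, hcont => by
    set ρ₀ : RF := { ρ with f := bits (ys.map Tok.bit) ++ rest, fr := fr, lb := lb, xr := xr } with hρ₀
    have h1 : Runs (scBit b) (mk ρ₀)
        (mk { ρ₀ with
              fr := (Tok.bit b).code.reverse ++ fr, lb := (Tok.bit b).code.reverse ++ lb, xr := b :: xr }) 11 := by
      unfold scBit
      have a := runs_emit R.fr (.bit b) (mk ρ₀)
      simp only [update_mk_fr, mk_fr] at a
      have c := runs_emit R.lb (.bit b) (mk { ρ₀ with fr := (Tok.bit b).code.reverse ++ ρ₀.fr })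
      simp only [update_mk_lb, mk_lb] at c
      refine (a.seq (c.seq (Runs.push' rfl))).of_eq ?_ (by omega)
      simp [hρ₀]
    have h2 := runs_scBits ys ((Tok.bit b).code.reverse ++ fr) ((Tok.bit b).code.reverse ++ lb) (b :: xr) rest ρ
      (R₂ := R₂) (B₂ := B₂) (hcont.of_eq_init (by simp [List.reverse_append]))
    have h := runs_tokLoop_cons (k := R.f) (H := scH) (t := .bit b) (rest := bits (ys.map Tok.bit) ++ rest)
      (Rg := mk { ρ with f := bits ((b :: ys).map Tok.bit) ++ rest, fr := fr, lb := lb, xr := xr })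
      (by simp) (by rw [scH_run]; exact h1.of_eq_init (by simp [hρ₀])) (h2.of_eq_init (by simp [hρ₀]))
    exact h.of_eq rfl (by simp; omega)

/-- **The end of a literal `(y, b)`** after its bits: the literal is evaluated under the
assignment `al` coded in `f2` and `sat` accumulates its value; within
`(23 |y| + 95) |code al| + 5 |y| + 19` steps. [folklore] -/
theorem runs_scPol (b st : Bool) (ys fr lb : List Bool) (al : Assg) (ρ : RF) :
    Runs (scPol b)
      (mk { ρ with
            fr := fr, lb := lb, xr := ys.reverse, x := [], ls := [], sat := flag st
            md := [], xc := [], mis := [], t := [], u := [], f2 := bits (aToks al), f2r := [] })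
      (mk { ρ with
            fr := (Tok.pol b).code.reverse ++ fr, lb := (Tok.pol b).code.reverse ++ lb, xr := [], x := []
            ls := [], sat := flag (st || Literal.eval (valOf al) (ys, b))
            md := [], xc := [], mis := [], t := [], u := [], f2 := bits (aToks al), f2r := [] })
      ((23 * ys.length + 95) * (bits (aToks al)).length + 5 * ys.length + 19) := by
  unfold scPol
  set ρ₀ : RF := { ρ with
    fr := fr, lb := lb, xr := ys.reverse, x := [], ls := [], sat := flag st
    md := [], xc := [], mis := [], t := [], u := [], f2 := bits (aToks al), f2r := [] } with hρ₀
  have h1 := runs_emit R.fr (.pol b) (mk ρ₀)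
  simp only [update_mk_fr, mk_fr] at h1
  have h2 := runs_emit R.lb (.pol b) (mk { ρ₀ with fr := (Tok.pol b).code.reverse ++ ρ₀.fr })
  simp only [update_mk_lb, mk_lb] at h2
  set ρ₂ : RF := { ρ₀ with fr := (Tok.pol b).code.reverse ++ fr, lb := (Tok.pol b).code.reverse ++ lb } with hρ₂
  have h3 := runs_pour (a := R.xr) (b := R.x) (by decide) (mk ρ₂)
  simp only [mk_x, update_mk_xr, update_mk_x] at h3
  set ρ₃ : RF := { ρ₂ with xr := [], x := ys } with hρ₃
  have h4 := runs_lookup .val al false ys ρ₃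
  rw [luOut_of_ne_flip (by decide), luFlag_val, Bool.false_or] at h4
  set ρ₄ : RF := { ρ₃ with
    md := [], xc := [], mis := [], t := [], u := [], x := ys, f2r := [], ls := flag (valOf al ys)
    f2 := bits (aToks al) } with hρ₄
  have h5 : Runs (popFlag .ls (if b then setFlag .sat else .skip) (if b then .skip else setFlag .sat)) (mk ρ₄)
      (mk { ρ₄ with ls := [], sat := flag (st || Literal.eval (valOf al) (ys, b)) }) (3 + 2) := by
    refine runs_popFlag (b := valOf al ys) (by simp [hρ₄]) (fun hv => ?_) (fun hv => ?_)
    · rw [update_mk_ls]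
      cases b
      · refine (Runs.skip _).of_eq ?_ (by omega)
        simp [hρ₄, hρ₃, hρ₂, hρ₀, Literal.eval, hv]
      · have := runs_setFlag R.sat (mk { ρ₄ with ls := [] }) (by cases st <;> simp [hρ₄, hρ₃, hρ₂, hρ₀])
        refine this.of_eq ?_ le_rfl
        simp [hρ₄, hρ₃, hρ₂, hρ₀, Literal.eval, hv]
    · cases b
      · have := runs_setFlag R.sat (mk ρ₄) (by cases st <;> simp [hρ₄, hρ₃, hρ₂, hρ₀])
        refine this.of_eq ?_ le_rfl
        simp [hρ₄, hρ₃, hρ₂, hρ₀, Literal.eval, hv]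
      · refine (Runs.skip _).of_eq ?_ (by omega)
        simp [hρ₄, hρ₃, hρ₂, hρ₀, Literal.eval, hv]
  set ρ₅ : RF := { ρ₄ with ls := [], sat := flag (st || Literal.eval (valOf al) (ys, b)) } with hρ₅
  have h6 := runs_clear R.x (mk ρ₅)
  refine (h1.seq (h2.seq (h3.seq ((h4.of_eq_init ?_).seq (h5.seq h6))))).of_eq ?_ ?_
  · simp [hρ₃, hρ₂, hρ₀]
  · simp [hρ₅, hρ₄, hρ₃, hρ₂, hρ₀]
  · simp only [hρ₅, hρ₄, hρ₃, hρ₂, hρ₀, mk_xr, mk_x, List.length_reverse]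
    ring_nf
    omega

/-- **One literal** (continuation-passing form): bits then `pol`; within
`95 (|code al| + 1) (|y| + 1)` steps. [folklore] -/
theorem runs_scLit (l : Literal (List Bool)) (st : Bool) (fr lb rest : List Bool) (al : Assg) (ρ : RF)
    {R₂ : Regs R} {B₂ : ℕ}
    (hcont : Runs (tokLoop .f scH)
      (mk { ρ with
            f := rest, fr := (bits (eToks l)).reverse ++ fr, lb := (bits (eToks l)).reverse ++ lb, xr := [], x := []
            ls := [], sat := flag (st || Literal.eval (valOf al) l)
            md := [], xc := [], mis := [], t := [], u := [], f2 := bits (aToks al), f2r := [] }) R₂ B₂) :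
    Runs (tokLoop .f scH)
      (mk { ρ with
            f := bits (eToks l) ++ rest, fr := fr, lb := lb, xr := [], x := [], ls := [], sat := flag st
            md := [], xc := [], mis := [], t := [], u := [], f2 := bits (aToks al), f2r := [] }) R₂
      (95 * ((bits (aToks al)).length + 1) * (l.1.length + 1) + B₂) := by
  obtain ⟨ys, b⟩ := l
  simp only [eToks, bits_append, bits_cons, bits_nil, List.append_nil, List.reverse_append,
    List.append_assoc] at hcont ⊢
  set ρb : RF := { ρ with
    x := [], ls := [], sat := flag st, md := [], xc := [], mis := [], t := [], u := []
    f2 := bits (aToks al), f2r := [] } with hρb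
  -- the closing `pol b`
  have hpol : Runs (tokLoop .f scH)
      (mk { ρb with
            f := (Tok.pol b).code ++ rest, fr := (bits (ys.map Tok.bit)).reverse ++ fr
            lb := (bits (ys.map Tok.bit)).reverse ++ lb, xr := ys.reverse ++ [] })
      R₂ ((23 * ys.length + 95) * (bits (aToks al)).length + 5 * ys.length + 19 + 10 + B₂) := by
    have h1 := runs_scPol b st ys ((bits (ys.map Tok.bit)).reverse ++ fr) ((bits (ys.map Tok.bit)).reverse ++ lb) al
      { ρ with f := rest }
    refine runs_tokLoop_cons (t := .pol b) (rest := rest) (by simp [hρb]) (by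
      rw [scH_run]; exact h1.of_eq_init (by simp [hρb])) (hcont.of_eq_init ?_)
    simp
  have h := runs_scBits ys fr lb [] ((Tok.pol b).code ++ rest) ρb hpol
  refine (h.of_eq_init (by simp [hρb])).mono ?_
  nlinarith [Nat.zero_le ys.length, Nat.zero_le (bits (aToks al)).length]

/-- **The literals of a clause** (continuation-passing form); within
`95 (|code al| + 1) |code lits|` steps. [folklore] -/
theorem runs_scLits (al : Assg) : ∀ (c : Clause (List Bool)) (st : Bool) (fr lb rest : List Bool) (ρ : RF)
    {R₂ : Regs R} {B₂ : ℕ},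
    Runs (tokLoop .f scH)
      (mk { ρ with
            f := rest, fr := (bits (aToks c)).reverse ++ fr, lb := (bits (aToks c)).reverse ++ lb, xr := [], x := []
            ls := [], sat := flag (st || Clause.eval (valOf al) c)
            md := [], xc := [], mis := [], t := [], u := [], f2 := bits (aToks al), f2r := [] }) R₂ B₂ →
    Runs (tokLoop .f scH)
      (mk { ρ with
            f := bits (aToks c) ++ rest, fr := fr, lb := lb, xr := [], x := [], ls := [], sat := flag st
            md := [], xc := [], mis := [], t := [], u := [], f2 := bits (aToks al), f2r := [] }) R₂
      (95 * ((bits (aToks al)).length + 1) * (bits (aToks c)).length + B₂)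
  | [], st, fr, lb, rest, ρ, R₂, B₂, hcont => by
    refine (hcont.of_eq_init ?_).mono (by simp)
    simp [Clause.eval]
  | l :: c, st, fr, lb, rest, ρ, R₂, B₂, hcont => by
    have h2 := runs_scLits al c (st || Literal.eval (valOf al) l) ((bits (eToks l)).reverse ++ fr)
      ((bits (eToks l)).reverse ++ lb) rest ρ (R₂ := R₂) (B₂ := B₂) (hcont.of_eq_init (by
        simp [Clause.eval, List.reverse_append, Bool.or_assoc]))
    have h1 := runs_scLit l st fr lb (bits (aToks c) ++ rest) al ρ h2
    refine (h1.of_eq_init (by simp)).mono ?_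
    simp only [aToks_cons, bits_append, List.length_append, length_bits_eToks]
    nlinarith [Nat.zero_le l.1.length, Nat.zero_le (bits (aToks al)).length, Nat.zero_le (bits (aToks c)).length]

/-! ### Simulation: clauses and the formula -/

/-- **The end of a clause** (`scEndc` after the literals, `lb` holding the reversed code of
the literals, `sat = flag st`, `he = flag fd`): the pair `(he, cb)` becomes
`scanStep`, `lb` and `sat` are cleared; within `3 |code c| + 18` steps. [folklore] -/
theorem runs_scEndc (c : Clause (List Bool)) (st fd : Bool) (fr cb : List Bool) (al : Assg)
    (hst : st = Clause.eval (valOf al) c) (ρ : RF) :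
    Runs scEndc
      (mk { ρ with fr := fr, lb := (bits (aToks c)).reverse, sat := flag st, he := flag fd, cb := cb })
      (mk { ρ with
            fr := Tok.endc.code.reverse ++ fr, lb := [], sat := []
            he := flag (scanStep al c (fd, cb)).1, cb := (scanStep al c (fd, cb)).2 })
      (3 * (bits (cToks c)).length + 18) := by
  unfold scEndc
  set ρ₀ : RF := { ρ with fr := fr, lb := (bits (aToks c)).reverse, sat := flag st, he := flag fd, cb := cb } with hρ₀
  have h1 := runs_emit R.fr .endc (mk ρ₀)
  simp only [update_mk_fr, mk_fr] at h1
  have h2 := runs_emit R.lb .endc (mk { ρ₀ with fr := Tok.endc.code.reverse ++ ρ₀.fr })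
  simp only [update_mk_lb, mk_lb] at h2
  set ρ₂ : RF := { ρ₀ with fr := Tok.endc.code.reverse ++ fr, lb := Tok.endc.code.reverse ++ (bits (aToks c)).reverse }
    with hρ₂
  have hlb : (Tok.endc.code.reverse ++ (bits (aToks c)).reverse).length = (bits (cToks c)).length := by
    simp [cToks]; omega
  have h3 : Runs (popFlag .he (.push .he true ;; clear .lb ;; popFlag .sat .skip .skip)
      (popFlag .sat (clear .lb) (pour .lb .cb ;; .push .he true))) (mk ρ₂)
      (mk { ρ₂ with
            lb := [], sat := [], he := flag (scanStep al c (fd, cb)).1, cb := (scanStep al c (fd, cb)).2 })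
      (3 * (bits (cToks c)).length + 6 + 2) := by
    refine runs_popFlag (b := fd) (by simp [hρ₂, hρ₀]) (fun hfd => ?_) (fun hfd => ?_)
    · -- already found: restore the flag, drop the buffer, reset `sat`
      subst hfd
      rw [update_mk_he]
      have a : Runs (.push R.he true) (mk { ρ₂ with he := [] }) (mk ρ₂) 1 := Runs.push' (by simp [hρ₂, hρ₀])
      have b := runs_clear R.lb (mk ρ₂)
      simp only [update_mk_lb, mk_lb] at b
      have d : Runs (popFlag .sat .skip .skip) (mk { ρ₂ with lb := [] }) (mk { ρ₂ with lb := [], sat := [] }) (0 + 2) :=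
        runs_popFlag (b := st) (by simp [hρ₂, hρ₀]) (fun _ => by rw [update_mk_sat]; exact Runs.skip _)
          (fun h => (Runs.skip _).of_eq (by simp [hρ₂, hρ₀, h]) le_rfl)
      refine (a.seq (b.seq d)).of_eq ?_ ?_
      · simp [hρ₂, hρ₀, scanStep]
      · rw [hρ₂]; simp only; rw [hlb]; omega
    · subst hfd
      refine (runs_popFlag (B := 3 * (bits (cToks c)).length + 4) (b := st) (by simp [hρ₂, hρ₀])
        (fun hs => ?_) (fun hs => ?_)).mono (by omega)
      · -- satisfied clause: drop the buffer
        rw [update_mk_sat]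
        have b := runs_clear R.lb (mk { ρ₂ with sat := [] })
        refine b.of_eq ?_ ?_
        · subst hs; simp [hρ₂, hρ₀, scanStep, ← hst]
        · simp only [hρ₂, mk_lb]; rw [hlb]; omega
      · -- violated clause: record it, raise `he`
        have p := runs_pour (a := R.lb) (b := R.cb) (by decide) (mk ρ₂)
        simp only [mk_cb, update_mk_lb, update_mk_cb] at p
        have q : Runs (.push R.he true) (mk { ρ₂ with lb := [], cb := (Tok.endc.code.reverse ++ (bits (aToks c)).reverse).reverse ++ ρ₂.cb })
            (mk { ρ₂ with lb := [], cb := bits (cToks c) ++ cb, he := [true] }) 1 :=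
          Runs.push' (by subst hs; simp [hρ₂, hρ₀, cToks])
        refine (p.seq q).of_eq ?_ ?_
        · subst hs; simp [hρ₂, hρ₀, scanStep, ← hst]
        · simp only [hρ₂, mk_lb]; rw [hlb]; omega
  refine (h1.seq (h2.seq h3)).of_eq ?_ (by omega)
  simp [hρ₂, hρ₀]

/-- **One clause** (continuation-passing form): its literals, then `endc`; within
`105 (|code al| + 1) |code c|` steps. [folklore] -/
theorem runs_scClause (c : Clause (List Bool)) (fd : Bool) (fr cb rest : List Bool) (al : Assg) (ρ : RF)
    {R₂ : Regs R} {B₂ : ℕ}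
    (hcont : Runs (tokLoop .f scH)
      (mk { ρ with
            f := rest, fr := (bits (cToks c)).reverse ++ fr, lb := [], xr := [], x := [], ls := [], sat := []
            he := flag (scanStep al c (fd, cb)).1, cb := (scanStep al c (fd, cb)).2
            md := [], xc := [], mis := [], t := [], u := [], f2 := bits (aToks al), f2r := [] }) R₂ B₂) :
    Runs (tokLoop .f scH)
      (mk { ρ with
            f := bits (cToks c) ++ rest, fr := fr, lb := [], xr := [], x := [], ls := [], sat := []
            he := flag fd, cb := cb
            md := [], xc := [], mis := [], t := [], u := [], f2 := bits (aToks al), f2r := [] }) R₂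
      (105 * ((bits (aToks al)).length + 1) * (bits (cToks c)).length + B₂) := by
  -- the closing `endc`
  have hend : Runs (tokLoop .f scH)
      (mk { ρ with
            f := Tok.endc.code ++ rest, fr := (bits (aToks c)).reverse ++ fr, lb := (bits (aToks c)).reverse ++ []
            xr := [], x := [], ls := [], sat := flag (false || Clause.eval (valOf al) c), he := flag fd, cb := cb
            md := [], xc := [], mis := [], t := [], u := [], f2 := bits (aToks al), f2r := [] })
      R₂ (3 * (bits (cToks c)).length + 18 + 10 + B₂) := by
    have h1 := runs_scEndc c (Clause.eval (valOf al) c) fd ((bits (aToks c)).reverse ++ fr) cb al rfl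
      { ρ with
        f := rest, xr := [], x := [], ls := [], md := [], xc := [], mis := [], t := [], u := []
        f2 := bits (aToks al), f2r := [] }
    refine runs_tokLoop_cons (t := .endc) (rest := rest) (by simp) (by
      rw [scH_run]; exact h1.of_eq_init (by simp)) (hcont.of_eq_init ?_)
    simp [cToks, List.reverse_append]
  have h := runs_scLits al c false fr [] (Tok.endc.code ++ rest) { ρ with he := flag fd, cb := cb } hend
  refine (h.of_eq_init (by simp [cToks])).mono ?_
  have : 4 ≤ (bits (cToks c)).length := by simp [cToks, Tok.code]
  have e : (bits (cToks c)).length = (bits (aToks c)).length + 4 := by simp [cToks, Tok.code]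
  nlinarith [Nat.zero_le (bits (aToks al)).length, Nat.zero_le (bits (aToks c)).length]

/-- **The clause list** (continuation-passing form); within `105 (|code al| + 1) |code F|` steps.
[folklore] -/
theorem runs_scFormula (al : Assg) : ∀ (F : CNF (List Bool)) (fd : Bool) (fr cb rest : List Bool) (ρ : RF)
    {R₂ : Regs R} {B₂ : ℕ},
    Runs (tokLoop .f scH)
      (mk { ρ with
            f := rest, fr := (bits (fToks F)).reverse ++ fr, lb := [], xr := [], x := [], ls := [], sat := []
            he := flag (scanFold al F (fd, cb)).1, cb := (scanFold al F (fd, cb)).2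
            md := [], xc := [], mis := [], t := [], u := [], f2 := bits (aToks al), f2r := [] }) R₂ B₂ →
    Runs (tokLoop .f scH)
      (mk { ρ with
            f := bits (fToks F) ++ rest, fr := fr, lb := [], xr := [], x := [], ls := [], sat := []
            he := flag fd, cb := cb
            md := [], xc := [], mis := [], t := [], u := [], f2 := bits (aToks al), f2r := [] }) R₂
      (105 * ((bits (aToks al)).length + 1) * (bits (fToks F)).length + B₂)
  | [], fd, fr, cb, rest, ρ, R₂, B₂, hcont => by
    refine (hcont.of_eq_init ?_).mono (by simp)
    simp
  | c :: F, fd, fr, cb, rest, ρ, R₂, B₂, hcont => by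
    have h2 := runs_scFormula al F (scanStep al c (fd, cb)).1 ((bits (cToks c)).reverse ++ fr) (scanStep al c (fd, cb)).2
      rest ρ (R₂ := R₂) (B₂ := B₂) (hcont.of_eq_init (by simp [List.reverse_append]))
    have h1 := runs_scClause c fd fr cb (bits (fToks F) ++ rest) al ρ h2
    refine (h1.of_eq_init (by simp)).mono ?_
    simp only [fToks_cons, bits_append, List.length_append]
    nlinarith [Nat.zero_le (bits (aToks al)).length, Nat.zero_le (bits (cToks c)).length,
      Nat.zero_le (bits (fToks F)).length]

/-- **The scan pass.** On `f = code F` with the assignment `al` coded in `f2`, from the rest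
state (buffers and flags down), `scan` leaves `f`, `f2` unchanged, `he = flag [some clause is
violated]`, `cb` holding the code of the first violated clause, everything else restored;
within `105 (|code al| + 1) |code F| + 3 |code F| + 2` steps. [folklore] -/
theorem runs_scan (F : CNF (List Bool)) (al : Assg) (ρ : RF) :
    Runs scan
      (mk { ρ with
            f := bits (fToks F), fr := [], lb := [], xr := [], x := [], ls := [], sat := [], he := [], cb := []
            md := [], xc := [], mis := [], t := [], u := [], f2 := bits (aToks al), f2r := [] })
      (mk { ρ with
            f := bits (fToks F), fr := [], lb := [], xr := [], x := [], ls := [], sat := []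
            he := flag (firstViolated F al).isSome, cb := scanOut F al
            md := [], xc := [], mis := [], t := [], u := [], f2 := bits (aToks al), f2r := [] })
      (105 * ((bits (aToks al)).length + 1) * (bits (fToks F)).length + 3 * (bits (fToks F)).length + 2) := by
  unfold scan
  set ρ₁ : RF := { ρ with
    f := [], fr := (bits (fToks F)).reverse ++ [], lb := [], xr := [], x := [], ls := [], sat := []
    he := flag (scanFold al F (false, [])).1, cb := (scanFold al F (false, [])).2
    md := [], xc := [], mis := [], t := [], u := [], f2 := bits (aToks al), f2r := [] } with hρ₁
  have h1 := runs_scFormula al F false [] [] [] ρ (R₂ := mk ρ₁) (B₂ := 1) (runs_tokLoop_nil (by simp))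
  have h2 := runs_pour (a := R.fr) (b := R.f) (by decide) (mk ρ₁)
  refine ((h1.of_eq_init (by simp)).seq h2).of_eq ?_ ?_
  · simp [hρ₁, scanFold_eq]
  · simp [hρ₁]; omega

end Literature.Computability.FineGrained.Schoening
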